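import Mathlib.NumberTheory.ArithmeticFunction.VonMangoldt
import HarnessLib

/-!
# The illusory majorant `Λ ≤ χ ∗ log` and the positivity step `S ≤ S₁` for `n² + 1` — PROVED

Solo seat `solo-Parity-blind` (summit `Parity`, conjunct `BatemanHorn`).  This file certifies the one
parity-breaking step of the "illusory" (exceptional-character) approach to primes in the thin sequence
`n² + 1` (the seat's Door E): for EVERY completely multiplicative `χ : ℕ → {−1, 0, 1}` (a real Dirichlet
character, or Liouville's `λ`),

* `zeta_mul_nonneg` — `λ := 1 ∗ χ ≥ 0` pointwise (at a prime power `λ(p^k) = ∑_{j ≤ k} χ(p)^j ∈ {0, 1, k+1}`,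
  and `λ` is multiplicative);
* `zeta_mul_mul_vonMangoldt` — `λ ∗ Λ = χ ∗ log` (from `ζ ∗ Λ = log`);
* `vonMangoldt_le_mul_log` — `Λ(n) ≤ λ'(n) := (χ ∗ log)(n) = ∑_{uv = n} χ(u) log v` for all `n`
  (the `u = 1` term of `λ ∗ Λ` is `Λ(n)`, the others are `≥ 0`);
* `sum_vonMangoldt_sq_add_one_le` — hence `S(X) := ∑_{ℓ ≤ X} Λ(ℓ² + 1) ≤ S₁(X) := ∑_{ℓ ≤ X} λ'(ℓ² + 1)`.

`λ'` is a divisor-type function of degree two twisted by `χ`; when `χ` is an exceptional character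
(`L(1,χ)` tiny) `S₁` is asymptotically `𝔖 X` and the inequality is the source of the illusory SHARP UPPER
bound for primes `n² + 1` (seat paper §7.3) — the integer shadow of Pellet's formula: `χ(ℓ² + 1)` has
complete-sum cancellation although `μ(ℓ² + 1)` is invisible.  The lower-bound direction is where the approach
stops (paper §7.4).  This is a REPRODUCTION of a classical device — Friedlander–Iwaniec, *Illusory sieve*,
IJNT 1 (2005); H. Iwaniec, *Conversations on the exceptional character*, in: Analytic Number Theory (Cetraro
2002), LNM 1891, §8, (8.7)–(8.12) [corpus: book:friedlandernd-analytic-number-theory pp. 98–99];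
J. Merikoski, arXiv:2108.01355, §1.1 — stated for arbitrary completely multiplicative `χ` with values in
`{−1, 0, 1}`.  No `sorry`, standard axioms.
-/

noncomputable section

open Finset
open ArithmeticFunction
open scoped ArithmeticFunction.zeta

namespace Summit.Parity.BatemanHorn.Theorems.SoloBlindLevel

namespace Illusory

/-! Throughout, `χ` is a completely multiplicative arithmetic function with values in `{−1, 0, 1}`
(e.g. a real Dirichlet character extended by `0`, or Liouville's function): hypotheses
`h1 : χ 1 = 1`, `hmul : ∀ m n, χ (m * n) = χ m * χ n`, `hv : ∀ n, χ n = 0 ∨ χ n = 1 ∨ χ n = -1`. -/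

variable {χ : ArithmeticFunction ℝ} (h1 : χ 1 = 1) (hmul : ∀ m n, χ (m * n) = χ m * χ n)
  (hv : ∀ n, χ n = 0 ∨ χ n = 1 ∨ χ n = -1)

section
include h1 hmul

/-- A completely multiplicative `χ` with `χ 1 = 1` is multiplicative. -/
theorem isMultiplicative : χ.IsMultiplicative :=
  ⟨h1, fun {m n} _ => hmul m n⟩

/-- Complete multiplicativity on powers: `χ(p^k) = χ(p)^k`. -/
theorem map_pow (p k : ℕ) : χ (p ^ k) = χ p ^ k := by
  induction k with
  | zero => simp [h1]
  | succ k ih => rw [pow_succ, hmul, ih, pow_succ]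

end

section
include hv

/-- `∑_{j ≤ k} c^j ≥ 0` for `c ∈ {0, 1, −1}`. -/
theorem geom_sum_nonneg_of_values (p k : ℕ) : 0 ≤ ∑ j ∈ range (k + 1), χ p ^ j := by
  rcases hv p with h | h | h
  · rw [h]
    exact Finset.sum_nonneg fun j _ => by positivity
  · rw [h]; simp only [one_pow, Finset.sum_const, Finset.card_range, nsmul_eq_mul, mul_one]; positivity
  · rw [h]
    induction k with
    | zero => simp
    | succ k ih =>
      rw [Finset.sum_range_succ]
      rcases neg_one_pow_eq_or ℝ (k + 1) with h1 | h1
      · rw [h1]; linarith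
      · -- the partial sum up to k is ≥ 1 when (−1)^(k+1) = −1, i.e. k even... argue via closed form
        have hk : ∑ j ∈ range (k + 1), (-1 : ℝ) ^ j = (1 - (-1) ^ (k + 1)) / 2 := by
          clear ih h1
          induction k with
          | zero => norm_num
          | succ k ih2 => rw [Finset.sum_range_succ, ih2, pow_succ]; ring
        rw [hk, h1]; norm_num

end

section
include h1 hmul

/-- `(1 ∗ χ)(p^k) = ∑_{j ≤ k} χ(p)^j`. -/
theorem zeta_mul_apply_prime_pow {p : ℕ} (hp : p.Prime) (k : ℕ) :
    ((ζ : ArithmeticFunction ℝ) * χ) (p ^ k) = ∑ j ∈ range (k + 1), χ p ^ j := by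
  rw [coe_zeta_mul_apply, Nat.divisors_prime_pow hp, Finset.sum_map]
  refine Finset.sum_congr rfl fun j _ => ?_
  simp [map_pow h1 hmul]

end

section
include h1 hmul hv

/-- **`λ = 1 ∗ χ ≥ 0`.** -/
theorem zeta_mul_nonneg (n : ℕ) : 0 ≤ ((ζ : ArithmeticFunction ℝ) * χ) n := by
  rcases eq_or_ne n 0 with rfl | hn
  · simp
  have hmult : ((ζ : ArithmeticFunction ℝ) * χ).IsMultiplicative :=
    isMultiplicative_zeta.natCast.mul (isMultiplicative h1 hmul)
  rw [hmult.multiplicative_factorization _ hn, Finsupp.prod]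
  refine Finset.prod_nonneg fun p hp => ?_
  have hpp : p.Prime := Nat.prime_of_mem_primeFactors (by simpa using hp)
  rw [zeta_mul_apply_prime_pow h1 hmul hpp]
  exact geom_sum_nonneg_of_values hv p _

end

/-- **`λ ∗ Λ = χ ∗ log`** (for any `χ`). -/
theorem zeta_mul_mul_vonMangoldt (χ : ArithmeticFunction ℝ) :
    ((ζ : ArithmeticFunction ℝ) * χ) * Λ = χ * log := by
  rw [mul_comm (ζ : ArithmeticFunction ℝ) χ, mul_assoc, zeta_mul_vonMangoldt]

section
include h1 hmul hv

/-- **The illusory majorant: `Λ(n) ≤ (χ ∗ log)(n) = ∑_{uv = n} χ(u) log v`.** -/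
theorem vonMangoldt_le_mul_log (n : ℕ) : Λ n ≤ (χ * log) n := by
  rcases eq_or_ne n 0 with rfl | hn
  · simp
  rw [← zeta_mul_mul_vonMangoldt χ, mul_apply]
  have hmem : ((1 : ℕ), n) ∈ n.divisorsAntidiagonal := by
    simp [Nat.mem_divisorsAntidiagonal, hn]
  have hone : ((ζ : ArithmeticFunction ℝ) * χ) 1 = 1 := by
    rw [coe_zeta_mul_apply, Nat.divisors_one, Finset.sum_singleton, h1]
  calc Λ n = ((ζ : ArithmeticFunction ℝ) * χ) 1 * Λ n := by rw [hone, one_mul]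
    _ ≤ ∑ x ∈ n.divisorsAntidiagonal, ((ζ : ArithmeticFunction ℝ) * χ) x.1 * Λ x.2 :=
        Finset.single_le_sum (f := fun x : ℕ × ℕ => ((ζ : ArithmeticFunction ℝ) * χ) x.1 * Λ x.2)
          (fun x _ => mul_nonneg (zeta_mul_nonneg h1 hmul hv _) vonMangoldt_nonneg) hmem

/-- The excess `(χ ∗ log)(n) − Λ(n)` (`= ∑_{uv = n, u > 1} λ(u) Λ(v)`) is non-negative. -/
theorem mul_log_sub_vonMangoldt_nonneg (n : ℕ) : 0 ≤ (χ * log) n - Λ n :=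
  sub_nonneg.mpr (vonMangoldt_le_mul_log h1 hmul hv n)

/-- **`S ≤ S₁` for `n² + 1`:** `∑_{ℓ ≤ X} Λ(ℓ² + 1) ≤ ∑_{ℓ ≤ X} (χ ∗ log)(ℓ² + 1)` for every real
character-like `χ` — the positivity step of the illusory sieve for the thin sequence `n² + 1`. -/
theorem sum_vonMangoldt_sq_add_one_le (X : ℕ) :
    ∑ ℓ ∈ Icc 1 X, Λ (ℓ ^ 2 + 1) ≤ ∑ ℓ ∈ Icc 1 X, (χ * log) (ℓ ^ 2 + 1) :=
  Finset.sum_le_sum fun _ _ => vonMangoldt_le_mul_log h1 hmul hv _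

end

/-- Sanity instance: the trivial "character" `χ = ζ` satisfies the three hypotheses (then the majorant
reads `Λ(n) ≤ ∑_{v ∣ n} log v = (ζ ∗ log)(n)`). -/
theorem zeta_hypotheses :
    (ζ : ArithmeticFunction ℝ) 1 = 1 ∧
    (∀ m n, (ζ : ArithmeticFunction ℝ) (m * n) = (ζ : ArithmeticFunction ℝ) m * (ζ : ArithmeticFunction ℝ) n) ∧
    (∀ n, (ζ : ArithmeticFunction ℝ) n = 0 ∨ (ζ : ArithmeticFunction ℝ) n = 1 ∨
      (ζ : ArithmeticFunction ℝ) n = -1) := by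
  refine ⟨by simp, fun m n => ?_, fun n => ?_⟩
  · rcases eq_or_ne m 0 with rfl | hm
    · simp
    rcases eq_or_ne n 0 with rfl | hn
    · simp
    simp [hm, hn]
  · rcases eq_or_ne n 0 with rfl | hn
    · left; simp
    · right; left; simp [hn]

end Illusory

end Summit.Parity.BatemanHorn.Theorems.SoloBlindLevel

end
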